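import Summits.BirchSwinnertonDyer.BirchSwinnertonDyer.Theorems.AdditiveBranchIMCGordTwoRankZeroCongruenceCert
import Summits.BirchSwinnertonDyer.BirchSwinnertonDyer.Theorems.AdditiveBranchIMCGordTwoRankZeroResidual
import HarnessLib

/-!
# Crux `GordTwoRankZeroOffCaseOne`: the two children BY NAME from PUBLISHED facts and ONE certified
# partner per non-CM content pair (`p ≥ 5`), the raw `T = 0` input only at `p = 3` (sequel of
# `AdditiveBranchIMCGordTwoRankZero{Residual,Congruence,CongruenceCert}`)

Cell `bsd-addord`, seat `bsd-addord-k1-c2` (D-0074 row B1), gen 2. HONEST FRAMING: theorems only; every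
published input a named-fact binder (the route's `PrintedFacts` / `ReadingFacts`, the CM formula `hCM`,
Pal `hPal`, Kato's component reading `hK`, Emerton–Pollack–Weston's branch transfer `hEPW`); the PARTNER
hypotheses are displayed per-pair CERTIFICATE demands — for every NON-CM CONTENT pair of the child, a
good ordinary curve `V₁` congruent mod `p` to the twist models of `E` whose own `p*`-twist is a rank-`0`
pair with unit algebraic `L`-value (even branch: (C1) + (C2′) of the Cert file) resp. unit branch constant
term (odd branch, `p ≥ 7`: (C1) + (C2)) — and are NOT asserted: whether every such class HAS a partner
is exactly the question «`μ(ρ̄, ω^{(p−1)/2}) = 0` and minimal `λ(ρ̄, ω^{(p−1)/2}) = 0` with a rational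
witness» (EPW Thm. 1 / §5), false in general (classes with minimal `λ > 0` exist) — so these theorems do
NOT close the children; they say precisely which pairs the published record reaches today:

* `gordTwoRankZeroOffCaseOneEven_of_facts_of_partners` — item 19244 BY NAME ⟸ facts + a certified
  partner for every non-CM content pair (`p ≡ 1 (mod 4)` forces `p ≥ 5`).
* `gordTwoRankZeroOffCaseOneOdd_of_facts_of_partners_of_three` — item 19245 BY NAME ⟸ facts + a
  certified partner for every non-CM content pair with `p ≥ 7` + the raw `T = 0` input
  `CycLowerLeadingTermAt W 3` on the non-CM content pairs at `p = 3` (no Hida theory at `3` in EPW: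
  Thm. 2.1.2 is printed for `p ≥ 5`; the `p = 3` rows are route W2's per-pair territory).

References: Emerton–Pollack–Weston 2006 Cor. 5.1.4 [EmertonPollackWeston2006]; Kato 2004 Thm. 17.4 (3)
[Kato2004Asterisque]; Pal 2012 Thm. 3.2 [Pal2012]; Delbourgo 1998 Prop. 4 [Delbourgo1998]; Burungale–Flach
2024 Thm. 1.1 / Cor. 2 [BurungaleFlach2024]; Miller 2011 Def. 1.1 [Miller2011LMS].
-/

set_option autoImplicit false
set_option linter.dupNamespace false

noncomputable section

open scoped Classical MatrixGroups ModularForm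

open CongruenceSubgroup WeierstrassCurve NumberField IsDedekindDomain Rat.HeightOneSpectrum
  Literature.NumberTheory.EllipticCurves
  Literature.NumberTheory.EllipticCurves.ModularForms
  Literature.NumberTheory.EllipticCurves.Rank1Residual
  Literature.NumberTheory.EllipticCurves.Rank1Residual.Typed
  Literature.NumberTheory.EllipticCurves.GreenbergVatsal2000
  Literature.NumberTheory.EllipticCurves.EmertonPollackWeston2006
  Literature.NumberTheory.GaloisRepresentations

namespace Summit.BirchSwinnertonDyer.BirchSwinnertonDyer.Theorems.AdditiveBranchIMCGordTwoRankZeroCongruence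

open Summit.BirchSwinnertonDyer.Rank1Residual.Additive
open Summit.BirchSwinnertonDyer.BirchSwinnertonDyer.Theses.AdditiveBranchIMC
open Summit.BirchSwinnertonDyer.BirchSwinnertonDyer.Theorems.AdditiveBranchIMCGordTwoRankZeroTransport
open Summit.BirchSwinnertonDyer.BirchSwinnertonDyer.Theorems.AdditiveBranchIMCGordTwoRankZeroResidual

/-- **Item 19244 `GordTwoRankZeroOffCaseOneEven` BY NAME from published facts and one certified partner
per non-CM content pair.** Facts: `PrintedFacts`, `ReadingFacts`, the CM formula `hCM` (Burungale–Flach),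
Pal `hPal`, Kato's component reading `hK`, EPW's branch transfer `hEPW`. Displayed demand `hPartner`: for
every globally minimal `W` and prime `p ≡ 1 (mod 4)` with `r_an = 0`, `N10.CellGordTwo W p`, no Case-1
member, `¬ W.HasCM` and `#Ш(W)_an` of positive valuation whenever rational, SOME partner: `V₁` globally
minimal good ordinary at `p` with `V₁[p]` irreducible and `ρ_{V₁,pⁿ}` onto (all `n`), its globally minimal
`p`-twist `E₁` additive at `p` of analytic rank `0` with `ord_p (L(E₁,1)/Ω_{E₁}) = 0` ((C2′)), and (C1) a
`Γ_ℚ`-equivariant `V₁[p] ≃ V[p]` for the good ordinary twist models `V` of `W`. CM rows by `hCM`,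
non-content rows trivially (gen-2 Residual file), the rest by `missingLowerBoundAt_rankZero_of_partner_LValueUnit`.
CONDITIONAL on `hPartner` (not a theorem: classes with minimal `λ(ρ̄, ω^{(p−1)/2}) > 0` have no partner);
closes nothing. [cite: EmertonPollackWeston2006, Cor. 5.1.4 (arXiv p30)] [cite: Kato2004Asterisque, Thm. 17.4 (3) (p. 273)]
[cite: Pal2012, Thm. 3.2] [cite: BurungaleFlach2024, Thm. 1.1 and Cor. 2] [cite: Delbourgo1998, Prop. 4 (p. 144)] -/
theorem gordTwoRankZeroOffCaseOneEven_of_facts_of_partners (hP : PrintedFacts) (hR : ReadingFacts)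
    (hCM : bsdTriple_of_hasCM_of_L_one_ne_zero)
    (hPal : Pal2012.thm32_sqrt_mul_realPeriodRat_twist_eq_of_prime_one_mod_four)
    (hK : Kato2004.charIdeal_dvd_padicLFunctionBranch_component_of_surjective)
    (hEPW : EmertonPollackWeston2006.cor514_branchTransfer_of_torsionIso)
    (hPartner : ∀ (W : WeierstrassCurve ℚ) [W.IsElliptic] [W.IsGloballyMinimal] (p : ℕ) [Fact p.Prime],
      W.analyticRank = 0 → N10.CellGordTwo W p → ¬ HasCaseOneMember W p → p % 4 = 1 → ¬ W.HasCM →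
      (∀ q : ℚ, shaAn W = (q : ℂ) → 0 < padicValRat p q) →
      ∃ (V₁ E₁ : WeierstrassCurve ℚ) (_ : V₁.IsElliptic) (_ : V₁.IsGloballyMinimal) (_ : E₁.IsElliptic)
        (_ : E₁.IsGloballyMinimal),
        (∃ C : VariableChange ℚ, C • V₁.quadraticTwist (p : ℚ) = E₁) ∧ GoodOrd V₁ p ∧
        V₁.HasIrreducibleModPGaloisRep p ∧ (∀ n : ℕ, V₁.HasSurjectiveModNGaloisRep (p ^ n : ℕ)) ∧
        Addv E₁ p ∧ E₁.analyticRank = 0 ∧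
        (∃ q : ℚ, E₁.entireLFunction 1 = (q : ℂ) * (E₁.realPeriodRat : ℂ) ∧ padicValRat p q = 0) ∧
        ∀ (V : WeierstrassCurve ℚ) [V.IsElliptic] [V.IsGloballyMinimal],
          (∃ C : VariableChange ℚ, C • V.quadraticTwist (p : ℚ) = W) → GoodOrd V p →
          ∃ e : geomTorsion V₁ (p : ℤ) ≃+ geomTorsion V (p : ℤ),
            ∀ (σ : Field.absoluteGaloisGroup ℚ) (P : geomTorsion V₁ (p : ℤ)), e (σ • P) = σ • e P) :
    GordTwoRankZeroOffCaseOneEven := by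
  have hGZK := hP.2.2.2.2.1
  have hmod := hP.2.2.2.2.2.1
  intro W _ _ p _ hr hc hno h1
  by_cases hcm : W.HasCM
  · exact AdditiveBranchIMCGordTwoRankOne.missingLowerBoundAt_rankZero_of_hasCM_of_burungaleFlach hCM hmod
      hGZK hcm hr
  by_cases hq : ∃ q : ℚ, shaAn W = (q : ℂ) ∧ padicValRat p q ≤ 0
  · obtain ⟨q, hq, hv⟩ := hq
    exact N10.missingLowerBoundAt_of_padicValRat_le_zero W p hq hv
  · push Not at hq
    have hp5 : 5 ≤ p := by
      have h2 := (Fact.out : p.Prime).two_le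
      omega
    obtain ⟨V₁, E₁, _, _, _, _, hCW₁, hV₁, hirr₁, hsurj₁, hadd₁, hr₁, hL₁, hiso⟩ :=
      hPartner W p hr hc hno h1 hcm hq
    exact missingLowerBoundAt_rankZero_of_partner_LValueUnit hP hR hPal hK hEPW hc h1 hp5 hr V₁ E₁ hCW₁ hV₁
      hirr₁ hsurj₁ hadd₁ hr₁ hL₁ hiso

/-- **Item 19245 `GordTwoRankZeroOffCaseOneOdd` BY NAME from published facts, one certified partner per
non-CM content pair with `p ≥ 7`, and the raw `T = 0` input at `p = 3`.** As the even twin, with the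
odd-branch partner demand — (C1) for the twist models by `−p` and (C2) in its modular-symbol form «the
constant term of `ϖ₁·L_p^{±}(f_{V₁}, α₁, ω^{(p−1)/2}, T)` has norm `1`» (the odd Birch identity carries an
extra rational factor, so no `L`-value form is offered) — and, at `p = 3` (where EPW's Hida theory is
not in print), the residual input `CycLowerLeadingTermAt W 3` itself on the non-CM content pairs
(route W2's per-pair territory). CONDITIONAL on the displayed demands; closes nothing.
[cite: EmertonPollackWeston2006, Cor. 5.1.4 (arXiv p30)] [cite: Kato2004Asterisque, Thm. 17.4 (3) (p. 273)]
[cite: BurungaleFlach2024, Thm. 1.1 and Cor. 2] [cite: Delbourgo1998, Prop. 4 (p. 144)] -/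
theorem gordTwoRankZeroOffCaseOneOdd_of_facts_of_partners_of_three (hP : PrintedFacts) (hR : ReadingFacts)
    (hCM : bsdTriple_of_hasCM_of_L_one_ne_zero)
    (hK : Kato2004.charIdeal_dvd_padicLFunctionBranch_component_of_surjective)
    (hEPW : EmertonPollackWeston2006.cor514_branchTransfer_of_torsionIso)
    (hThree : ∀ (W : WeierstrassCurve ℚ) [W.IsElliptic] [W.IsGloballyMinimal],
      W.analyticRank = 0 → N10.CellGordTwo W 3 → ¬ HasCaseOneMember W 3 → ¬ W.HasCM →
      (∀ q : ℚ, shaAn W = (q : ℂ) → 0 < padicValRat 3 q) → CycLowerLeadingTermAt W 3)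
    (hPartner : ∀ (W : WeierstrassCurve ℚ) [W.IsElliptic] [W.IsGloballyMinimal] (p : ℕ) [Fact p.Prime],
      W.analyticRank = 0 → N10.CellGordTwo W p → ¬ HasCaseOneMember W p → p % 4 = 3 → 7 ≤ p →
      ¬ W.HasCM → (∀ q : ℚ, shaAn W = (q : ℂ) → 0 < padicValRat p q) →
      ∃ (V₁ : WeierstrassCurve ℚ) (_ : V₁.IsElliptic) (_ : V₁.IsGloballyMinimal),
        IsOrdinaryAt V₁ p ∧ V₁.HasIrreducibleModPGaloisRep p ∧
        (∀ n : ℕ, V₁.HasSurjectiveModNGaloisRep (p ^ n : ℕ)) ∧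
        (∀ {N : ℕ} [NeZero N] (f : CuspForm (Gamma0 N) 2), IsNewformOf V₁ f → ∀ (ϖ : ℚ),
          (if Even (p / 2) then (ϖ : ℝ) * V₁.realPeriodRat = plusPeriod f
            else (ϖ : ℝ) * V₁.imaginaryPeriodRat = minusPeriod f) →
          ‖PowerSeries.constantCoeff (PowerSeries.C (ϖ : ℚ_[p]) *
            (if Even (p / 2) then padicLFunctionBranch f ((unitRoot V₁ p : ℤ_[p]) : ℚ_[p]) (p / 2)
              else padicLFunctionMinusBranch f ((unitRoot V₁ p : ℤ_[p]) : ℚ_[p]) (p / 2)))‖ = 1) ∧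
        ∀ (V : WeierstrassCurve ℚ) [V.IsElliptic] [V.IsGloballyMinimal],
          (∃ C : VariableChange ℚ, C • V.quadraticTwist (-(p : ℚ)) = W) → GoodOrd V p →
          ∃ e : geomTorsion V₁ (p : ℤ) ≃+ geomTorsion V (p : ℤ),
            ∀ (σ : Field.absoluteGaloisGroup ℚ) (P : geomTorsion V₁ (p : ℤ)), e (σ • P) = σ • e P) :
    GordTwoRankZeroOffCaseOneOdd := by
  obtain ⟨-, -, -, -, hGZK, hmod, hmodD, -⟩ := hP
  obtain ⟨-, -, -, -, hDelG⟩ := hR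
  intro W _ _ p _ hr hc hno h3
  by_cases hcm : W.HasCM
  · exact AdditiveBranchIMCGordTwoRankOne.missingLowerBoundAt_rankZero_of_hasCM_of_burungaleFlach hCM hmod
      hGZK hcm hr
  by_cases hq : ∃ q : ℚ, shaAn W = (q : ℂ) ∧ padicValRat p q ≤ 0
  · obtain ⟨q, hq, hv⟩ := hq
    exact N10.missingLowerBoundAt_of_padicValRat_le_zero W p hq hv
  · push Not at hq
    by_cases hp3 : p = 3
    · subst hp3
      exact missingLowerBoundAt_cellGordTwo_rankZero_of_cycLowerLeadingTerm hDelG hGZK hmod hc hr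
        (hThree W hr hc hno hcm hq)
    · have hp7 : 7 ≤ p := by
        have h2 := (Fact.out : p.Prime).two_le
        omega
      obtain ⟨V₁, _, _, hord₁, hirr₁, hsurj₁, hunit, hiso⟩ := hPartner W p hr hc hno h3 hp7 hcm hq
      exact missingLowerBoundAt_rankZero_of_branchTransfer_odd hEPW hDelG hGZK hmod hmodD hc h3 (by omega) hr
        V₁ hord₁ hirr₁ (branchCharIdealMuZeroEigen_of_katoComponent_of_unit hK V₁ hord₁ hsurj₁ hunit) hiso

end Summit.BirchSwinnertonDyer.BirchSwinnertonDyer.Theorems.AdditiveBranchIMCGordTwoRankZeroCongruence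

end
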